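import Mathlib.LinearAlgebra.Matrix.GeneralLinearGroup.Defs
import Mathlib.LinearAlgebra.Matrix.Invertible
import Mathlib.LinearAlgebra.Matrix.SchurComplement
import Mathlib.RingTheory.Jacobson.Ideal
import Mathlib.RingTheory.Ideal.Quotient.Basic
import Literature.NumberTheory.Automorphic.ParabolicGL
import HarnessLib

/-!
# Principal congruence kernels of `GL_ι(O)` and their Iwahori factorisation

Topic `NumberTheory/Automorphic`, namespace `Literature.NumberTheory.Automorphic.CongruenceKernel`.
Pure commutative algebra behind the compact open subgroups used in the proof of Jacquet's
admissibility theorem (`Literature.NumberTheory.Automorphic.jacquetAdmissibility_gl`,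
Bernstein–Zelevinsky 1976, Thm. 3.25). For a commutative ring `O`, an ideal `𝔞 ≤ O` and a finite
index type `ι`:

* `congruenceKer 𝔞 ι ≤ GL_ι(O)`: the kernel of reduction modulo `𝔞` (a normal subgroup),
  `mem_congruenceKer_iff`: `g ≡ 1 (mod 𝔞)` entrywise; `IsCongOne 𝔞 M`: the same congruence for a
  matrix, `IsCongOne.isUnit`: such a matrix is invertible as soon as `𝔞 ≤ Jac(O)` (its
  determinant is `≡ 1`), e.g. `O` local and `𝔞` proper.
* **Iwahori factorisation** (`exists_mul_eq_of_isCongOne`, `coe_congruenceKer_eq_mul`): for every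
  block labelling `b : ι → α` (any linear order `α`), every `k ≡ 1 (mod 𝔞)` factors as `k = u p`
  with `u ≡ 1` block upper unitriangular (`u ∈ U_b`, `Literature.NumberTheory.Automorphic.unipotentRadicalGL`)
  and `p ≡ 1` block LOWER triangular (`p ∈ P_b⁻`, the standard parabolic of the dual order); hence
  `K = (K ∩ U_b) · (K ∩ P_b⁻)` for `K = congruenceKer 𝔞 ι`. This is the two-factor form of the
  Iwahori factorisation `K = (K ∩ N) (K ∩ M) (K ∩ N⁻)` of the congruence subgroups of a reductive
  `p`-adic group with respect to a parabolic `P = M N` (Bernstein–Zelevinsky 1976, §3.13;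
  Casselman 1995, Prop. 1.4.4; Iwahori–Matsumoto 1965, §2), proved by block Gaussian elimination:
  writing `k = [[A, B], [C, D]]` along the top block, `D ≡ 1` is invertible and
  `k = [[1, B D⁻¹], [0, 1]] · [[A - B D⁻¹ C, 0], [C, D]]` with `A - B D⁻¹ C ≡ 1`, then induction
  on the number of indices.

## References

* I. N. Bernstein, A. V. Zelevinsky, *Representations of the group GL(n, F) where F is a
  non-archimedean local field*, Russian Math. Surveys 31:3 (1976), 1–68, §3.13.
* W. Casselman, *Introduction to the theory of admissible representations of p-adic reductive
  groups* (1995 notes), Prop. 1.4.4.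
* N. Iwahori, H. Matsumoto, *On some Bruhat decomposition and the structure of the Hecke rings of
  p-adic Chevalley groups*, Publ. Math. IHÉS 25 (1965), §2.
-/

open Matrix
open scoped Pointwise

universe u v

namespace Literature.NumberTheory.Automorphic.CongruenceKernel

/-! ### Matrices congruent to `1` -/

section CongOne

variable {O : Type u} [CommRing O] (𝔞 : Ideal O) {ι : Type v} [Fintype ι] [DecidableEq ι]

/-- `M ≡ 1 (mod 𝔞)` entrywise. [folklore] -/
def IsCongOne (M : Matrix ι ι O) : Prop := ∀ i j, M i j - (1 : Matrix ι ι O) i j ∈ 𝔞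

variable {𝔞}

omit [Fintype ι] in
/-- `M ≡ 1 (mod 𝔞)` iff the reduction of `M` modulo `𝔞` is the identity matrix. [folklore] -/
theorem isCongOne_iff_map_eq_one {M : Matrix ι ι O} :
    IsCongOne 𝔞 M ↔ M.map (Ideal.Quotient.mk 𝔞) = 1 := by
  rw [← Matrix.map_one (Ideal.Quotient.mk 𝔞) (map_zero _) (map_one _)]
  simp only [IsCongOne, ← Matrix.ext_iff, Matrix.map_apply, Ideal.Quotient.eq]

omit [Fintype ι] in
/-- The identity is congruent to `1`. [folklore] -/
theorem isCongOne_one : IsCongOne 𝔞 (1 : Matrix ι ι O) := fun i j => by simp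

/-- Products of matrices congruent to `1` are congruent to `1`. [folklore] -/
theorem IsCongOne.mul {M N : Matrix ι ι O} (hM : IsCongOne 𝔞 M) (hN : IsCongOne 𝔞 N) :
    IsCongOne 𝔞 (M * N) := by
  rw [isCongOne_iff_map_eq_one] at hM hN ⊢
  rw [Matrix.map_mul, hM, hN, one_mul]

/-- The determinant of a matrix congruent to `1` is congruent to `1`. [folklore] -/
theorem IsCongOne.det_sub_one_mem {M : Matrix ι ι O} (hM : IsCongOne 𝔞 M) : M.det - 1 ∈ 𝔞 := by
  rw [isCongOne_iff_map_eq_one] at hM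
  rw [← Ideal.Quotient.eq, RingHom.map_det, RingHom.mapMatrix_apply, hM, det_one, map_one]

/-- A matrix congruent to `1` modulo an ideal inside the Jacobson radical is invertible.
[folklore] -/
theorem IsCongOne.isUnit (h𝔞 : 𝔞 ≤ Ideal.jacobson ⊥) {M : Matrix ι ι O} (hM : IsCongOne 𝔞 M) :
    IsUnit M :=
  (Matrix.isUnit_iff_isUnit_det M).2
    (Ideal.isUnit_of_sub_one_mem_jacobson_bot _ (h𝔞 hM.det_sub_one_mem))

/-- If `M ≡ 1` and `M N = 1` then `N ≡ 1`. [folklore] -/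
theorem IsCongOne.of_mul_eq_one {M N : Matrix ι ι O} (hM : IsCongOne 𝔞 M) (h : M * N = 1) :
    IsCongOne 𝔞 N := by
  rw [isCongOne_iff_map_eq_one] at hM ⊢
  have := congrArg (fun X : Matrix ι ι O => X.map (Ideal.Quotient.mk 𝔞)) h
  simp only [Matrix.map_mul, hM, one_mul] at this
  rwa [Matrix.map_one _ (map_zero _) (map_one _)] at this

/-- The inverse of an invertible matrix congruent to `1` is congruent to `1`. [folklore] -/
theorem IsCongOne.invOf {M : Matrix ι ι O} [Invertible M] (hM : IsCongOne 𝔞 M) :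
    IsCongOne 𝔞 (⅟M) :=
  hM.of_mul_eq_one (mul_invOf_self M)

omit [Fintype ι] in
/-- Congruence to `1` is preserved by reindexing along an equivalence. [folklore] -/
theorem IsCongOne.submatrix {κ : Type*} [DecidableEq κ] {M : Matrix ι ι O}
    (hM : IsCongOne 𝔞 M) (e : κ ≃ ι) : IsCongOne 𝔞 (M.submatrix e e) := by
  rw [isCongOne_iff_map_eq_one] at hM ⊢
  rw [← Matrix.submatrix_map, hM, Matrix.submatrix_one_equiv]

/-- A block matrix is congruent to `1` iff its diagonal blocks are and its off-diagonal blocks are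
`≡ 0`. [folklore] -/
theorem isCongOne_fromBlocks_iff {κ κ' : Type*} [Fintype κ] [DecidableEq κ] [Fintype κ']
    [DecidableEq κ'] {A : Matrix κ κ O} {B : Matrix κ κ' O} {C : Matrix κ' κ O} {D : Matrix κ' κ' O} :
    IsCongOne 𝔞 (fromBlocks A B C D) ↔ IsCongOne 𝔞 A ∧ B.map (Ideal.Quotient.mk 𝔞) = 0 ∧
      C.map (Ideal.Quotient.mk 𝔞) = 0 ∧ IsCongOne 𝔞 D := by
  rw [isCongOne_iff_map_eq_one, isCongOne_iff_map_eq_one, isCongOne_iff_map_eq_one,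
    Matrix.fromBlocks_map, ← Matrix.fromBlocks_one, Matrix.fromBlocks_inj]

end CongOne

/-! ### The congruence kernel -/

section Kernel

variable {O : Type u} [CommRing O] (𝔞 : Ideal O) (ι : Type v) [Fintype ι] [DecidableEq ι]

/-- The **principal congruence kernel** of level `𝔞`: the kernel of the reduction homomorphism
`GL_ι(O) → GL_ι(O/𝔞)` (for `O = 𝒪_F`, `𝔞 = 𝔭^m`: the group `1 + ϖ^m M_ι(𝒪_F)`;
Bernstein–Zelevinsky 1976, §3.13; Bushnell–Henniart 2006, §12.4). [folklore] -/
def congruenceKer : Subgroup (GL ι O) := (Matrix.GeneralLinearGroup.map (Ideal.Quotient.mk 𝔞)).ker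

/-- The congruence kernel is a normal subgroup of `GL_ι(O)`. [folklore] -/
instance normal_congruenceKer : (congruenceKer 𝔞 ι).Normal :=
  inferInstanceAs (Matrix.GeneralLinearGroup.map (n := ι) (Ideal.Quotient.mk 𝔞)).ker.Normal

variable {𝔞 ι}

/-- `g` lies in the congruence kernel iff `g ≡ 1 (mod 𝔞)` entrywise. [folklore] -/
theorem mem_congruenceKer_iff (g : GL ι O) :
    g ∈ congruenceKer 𝔞 ι ↔ IsCongOne 𝔞 (g : Matrix ι ι O) := by
  rw [congruenceKer, MonoidHom.mem_ker, isCongOne_iff_map_eq_one, Units.ext_iff]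
  rfl

/-- A matrix congruent to `1` modulo `𝔞 ≤ Jac(O)`, as an element of the congruence kernel.
[folklore] -/
noncomputable def unitOfIsCongOne (h𝔞 : 𝔞 ≤ Ideal.jacobson ⊥) (M : Matrix ι ι O)
    (hM : IsCongOne 𝔞 M) : GL ι O :=
  (hM.isUnit h𝔞).unit

/-- The underlying matrix of `unitOfIsCongOne`. [folklore] -/
@[simp] theorem coe_unitOfIsCongOne (h𝔞 : 𝔞 ≤ Ideal.jacobson ⊥) (M : Matrix ι ι O)
    (hM : IsCongOne 𝔞 M) : (unitOfIsCongOne h𝔞 M hM : Matrix ι ι O) = M :=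
  IsUnit.unit_spec _

/-- `unitOfIsCongOne` lands in the congruence kernel. [folklore] -/
theorem unitOfIsCongOne_mem (h𝔞 : 𝔞 ≤ Ideal.jacobson ⊥) (M : Matrix ι ι O) (hM : IsCongOne 𝔞 M) :
    unitOfIsCongOne h𝔞 M hM ∈ congruenceKer 𝔞 ι := by
  rw [mem_congruenceKer_iff, coe_unitOfIsCongOne]
  exact hM

end Kernel

/-! ### Iwahori factorisation -/

section Iwahori

variable {O : Type u} [CommRing O] {𝔞 : Ideal O} {α : Type*} [LinearOrder α]

/-- Entries of a matrix reindexed along `Equiv.sumCompl q`, in the four cases. [folklore] -/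
theorem submatrix_sumCompl_apply {ι : Type v} (q : ι → Prop) [DecidablePred q] {R : Type*}
    (M : Matrix ({i // q i} ⊕ {i // ¬ q i}) ({i // q i} ⊕ {i // ¬ q i}) R) (i j : ι) :
    M.submatrix (Equiv.sumCompl q).symm (Equiv.sumCompl q).symm i j =
      if hi : q i then
        (if hj : q j then M (Sum.inl ⟨i, hi⟩) (Sum.inl ⟨j, hj⟩) else M (Sum.inl ⟨i, hi⟩) (Sum.inr ⟨j, hj⟩))
      else
        (if hj : q j then M (Sum.inr ⟨i, hi⟩) (Sum.inl ⟨j, hj⟩) else M (Sum.inr ⟨i, hi⟩) (Sum.inr ⟨j, hj⟩)) := by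
  simp only [Matrix.submatrix_apply]
  by_cases hi : q i <;> by_cases hj : q j <;>
    simp [hi, hj, Equiv.sumCompl_symm_apply_of_pos, Equiv.sumCompl_symm_apply_of_neg]

/-- **Iwahori factorisation, matrix form.** Let `𝔞 ≤ Jac(O)`. For every block labelling
`b : ι → α` and every matrix `k ≡ 1 (mod 𝔞)` there are matrices `u`, `p` with `p ≡ 1 (mod 𝔞)`,
`u` block upper triangular with identity diagonal blocks, `p` block lower triangular, and
`k = u p`. Proof by induction on the number of indices: split off the top block `T = {b = max}`;
with `k = [[A, B], [C, D]]`, `D ≡ 1` is invertible and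
`k = [[1, B D⁻¹], [0, 1]] · [[A - B D⁻¹ C, 0], [C, D]]`, where `A - B D⁻¹ C ≡ 1` is factorised
by induction (Bernstein–Zelevinsky 1976, §3.13; Casselman 1995, Prop. 1.4.4).
[cite: BernsteinZelevinsky1976, §3.13] -/
theorem exists_mul_eq_of_isCongOne (h𝔞 : 𝔞 ≤ Ideal.jacobson ⊥) :
    ∀ (n : ℕ) (ι : Type v) [Fintype ι] [DecidableEq ι], Fintype.card ι = n →
    ∀ (b : ι → α) (k : Matrix ι ι O), IsCongOne 𝔞 k →
    ∃ u p : Matrix ι ι O, IsCongOne 𝔞 p ∧ u.BlockTriangular b ∧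
      (∀ i j, b i = b j → u i j = (1 : Matrix ι ι O) i j) ∧
      p.BlockTriangular (OrderDual.toDual ∘ b) ∧ k = u * p := by
  intro n
  induction n using Nat.strong_induction_on with
  | _ n ih =>
  intro ι _ _ hn b k hk
  -- the empty case and the one-block case: `k = 1 * k`
  by_cases htriv : ∀ i j : ι, b i = b j
  · refine ⟨1, k, hk, blockTriangular_one, fun i j _ => rfl, fun i j hij => ?_, (one_mul k).symm⟩
    have hij' : b i < b j := hij
    exact absurd (htriv i j) (ne_of_lt hij')
  -- otherwise split off the top block
  push Not at htriv
  obtain ⟨i₀, j₀, hij₀⟩ := htriv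
  haveI : Nonempty ι := ⟨i₀⟩
  set β : α := Finset.univ.sup' Finset.univ_nonempty b with hβ
  have hle : ∀ i, b i ≤ β := fun i => Finset.le_sup' b (Finset.mem_univ i)
  set q : ι → Prop := fun i => b i < β with hq
  -- the two parts are non-empty, so the induction applies to `S = {b < β}`
  obtain ⟨t₀, ht₀⟩ : ∃ t₀, b t₀ = β := by
    obtain ⟨t, -, ht⟩ := Finset.exists_mem_eq_sup' Finset.univ_nonempty b
    exact ⟨t, ht.symm⟩
  have hS : Fintype.card {i // q i} < n := by
    rw [← hn]
    exact Fintype.card_subtype_lt (x := t₀) (by simp [hq, ht₀])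
  -- block decomposition of `k`
  set e := Equiv.sumCompl q with he
  set k' : Matrix ({i // q i} ⊕ {i // ¬ q i}) ({i // q i} ⊕ {i // ¬ q i}) O := k.submatrix e e
    with hk'
  have hk'c : IsCongOne 𝔞 k' := hk.submatrix e
  set A := k'.toBlocks₁₁
  set B := k'.toBlocks₁₂
  set C := k'.toBlocks₂₁
  set D := k'.toBlocks₂₂
  have hkABCD : k' = fromBlocks A B C D := (fromBlocks_toBlocks k').symm
  rw [hkABCD, isCongOne_fromBlocks_iff] at hk'c
  obtain ⟨hA, hB, hC, hD⟩ := hk'c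
  letI : Invertible D := (hD.isUnit h𝔞).invertible
  -- the Schur complement is again `≡ 1`
  have hA' : IsCongOne 𝔞 (A - B * ⅟D * C) := by
    rw [isCongOne_iff_map_eq_one] at hA ⊢
    rw [Matrix.map_sub _ (map_sub _), Matrix.map_mul, Matrix.map_mul, hB, Matrix.zero_mul,
      Matrix.zero_mul, sub_zero, hA]
  obtain ⟨u₂, p₂, hp₂, hu₂, hu₂d, hp₂l, hAup⟩ :=
    ih _ hS {i // q i} rfl (b ∘ Subtype.val) (A - B * ⅟D * C) hA'
  -- the factors, in block form
  set u' : Matrix ({i // q i} ⊕ {i // ¬ q i}) ({i // q i} ⊕ {i // ¬ q i}) O :=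
    fromBlocks u₂ (B * ⅟D) 0 1 with hu'
  set p' : Matrix ({i // q i} ⊕ {i // ¬ q i}) ({i // q i} ⊕ {i // ¬ q i}) O :=
    fromBlocks p₂ 0 C D with hp'
  have hmul' : k' = u' * p' := by
    rw [hkABCD, hu', hp', fromBlocks_multiply]
    simp only [Matrix.mul_zero, zero_add, one_mul, Matrix.zero_mul, Matrix.one_mul]
    rw [← hAup, Matrix.invOf_mul_cancel_right, sub_add_cancel]
  have hp'c : IsCongOne 𝔞 p' := by
    rw [hp', isCongOne_fromBlocks_iff]
    exact ⟨hp₂, by rw [Matrix.map_zero _ (map_zero _)], hC, hD⟩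
  -- back to `ι`
  refine ⟨u'.submatrix e.symm e.symm, p'.submatrix e.symm e.symm, hp'c.submatrix e.symm,
    ?_, ?_, ?_, ?_⟩
  · -- `u` is block upper triangular
    intro i j hij
    rw [he, submatrix_sumCompl_apply]
    by_cases hi : q i <;> by_cases hj : q j
    · simp only [hi, hj, dite_true, hu', fromBlocks_apply₁₁]
      exact hu₂ hij
    · exact absurd (lt_of_lt_of_le hij (hle i)) (by simpa [hq] using hj)
    · simp only [hi, hj, dite_true, dite_false, hu', fromBlocks_apply₂₁, Matrix.zero_apply]
    · have hbi : b i = β := le_antisymm (hle i) (not_lt.1 hi)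
      have hbj : b j = β := le_antisymm (hle j) (not_lt.1 hj)
      exact absurd (hbi.trans hbj.symm) (ne_of_gt hij)
  · -- the diagonal blocks of `u` are identities
    intro i j hij
    rw [he, submatrix_sumCompl_apply]
    by_cases hi : q i <;> by_cases hj : q j
    · simp only [hi, hj, dite_true, hu', fromBlocks_apply₁₁]
      rw [hu₂d ⟨i, hi⟩ ⟨j, hj⟩ hij]
      by_cases h : i = j
      · subst h; simp
      · have h' : (⟨i, hi⟩ : {i // q i}) ≠ ⟨j, hj⟩ := fun h'' => h (congrArg Subtype.val h'')
        simp [Matrix.one_apply_ne h', Matrix.one_apply_ne h]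
    · exact absurd (show q j by simp only [hq] at hi ⊢; rwa [← hij]) hj
    · exact absurd (show q i by simp only [hq] at hj ⊢; rwa [hij]) hi
    · simp only [hi, hj, dite_false, hu', fromBlocks_apply₂₂]
      by_cases h : i = j
      · subst h; simp
      · have h' : (⟨i, hi⟩ : {i // ¬ q i}) ≠ ⟨j, hj⟩ := fun h'' => h (congrArg Subtype.val h'')
        simp [Matrix.one_apply_ne h', Matrix.one_apply_ne h]
  · -- `p` is block lower triangular
    intro i j hij
    have hij' : b i < b j := hij
    rw [he, submatrix_sumCompl_apply]
    by_cases hi : q i <;> by_cases hj : q j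
    · simp only [hi, hj, dite_true, hp', fromBlocks_apply₁₁]
      exact hp₂l (show (OrderDual.toDual ∘ b ∘ Subtype.val) ⟨j, hj⟩ <
        (OrderDual.toDual ∘ b ∘ Subtype.val) ⟨i, hi⟩ from hij)
    · simp only [hi, hj, dite_true, dite_false, hp', fromBlocks_apply₁₂, Matrix.zero_apply]
    · have hbi : b i = β := le_antisymm (hle i) (not_lt.1 hi)
      exact absurd (hbi ▸ hij') (not_lt.2 (hle j))
    · have hbi : b i = β := le_antisymm (hle i) (not_lt.1 hi)
      have hbj : b j = β := le_antisymm (hle j) (not_lt.1 hj)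
      exact absurd (hbi.trans hbj.symm) (ne_of_lt hij')
  · -- `k = u p`
    have : k = k'.submatrix e.symm e.symm := by
      rw [hk', Matrix.submatrix_submatrix]
      simp
    rw [this, hmul', Matrix.submatrix_mul_equiv]

variable {ι : Type v} [Fintype ι] [DecidableEq ι]

/-- **Iwahori factorisation of the congruence kernel.** Let `𝔞 ≤ Jac(O)` (e.g. `O` local, `𝔞`
proper). For every block labelling `b : ι → α`, every `k ∈ K = congruenceKer 𝔞 ι` is `k = u p`
with `u ∈ K ∩ U_b` (block upper unitriangular) and `p ∈ K ∩ P_b⁻` (block lower triangular)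
(Bernstein–Zelevinsky 1976, §3.13; Casselman 1995, Prop. 1.4.4). [cite: BernsteinZelevinsky1976, §3.13] -/
theorem exists_unipotent_mul_lower (h𝔞 : 𝔞 ≤ Ideal.jacobson ⊥) (b : ι → α) {k : GL ι O}
    (hk : k ∈ congruenceKer 𝔞 ι) :
    ∃ u ∈ congruenceKer 𝔞 ι, ∃ p ∈ congruenceKer 𝔞 ι,
      u ∈ unipotentRadicalGL O b ∧ p ∈ standardParabolicGL O (OrderDual.toDual ∘ b) ∧ k = u * p := by
  obtain ⟨u, p, hp, hu, hud, hpl, hkup⟩ := exists_mul_eq_of_isCongOne h𝔞 _ ι rfl b k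
    ((mem_congruenceKer_iff k).1 hk)
  set pu : GL ι O := unitOfIsCongOne h𝔞 p hp with hpu
  have hpu_mem : pu ∈ congruenceKer 𝔞 ι := unitOfIsCongOne_mem h𝔞 p hp
  have hcoe : ((k * pu⁻¹ : GL ι O) : Matrix ι ι O) = u := by
    rw [Units.val_mul, hkup, ← coe_unitOfIsCongOne h𝔞 p hp, ← hpu, mul_assoc, Units.mul_inv,
      mul_one]
  refine ⟨k * pu⁻¹, Subgroup.mul_mem _ hk (Subgroup.inv_mem _ hpu_mem), pu, hpu_mem, ?_, ?_,
    by group⟩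
  · rw [mem_unipotentRadicalGL_iff, hcoe]
    refine ⟨hu, fun a => ?_⟩
    ext ⟨i, hi⟩ ⟨j, hj⟩
    rw [Matrix.toSquareBlock_def, Matrix.of_apply, hud i j (hi.trans hj.symm)]
    by_cases h : i = j
    · subst h; simp
    · have h' : (⟨i, hi⟩ : {l // b l = a}) ≠ ⟨j, hj⟩ := fun h'' => h (congrArg Subtype.val h'')
      rw [Matrix.one_apply_ne h, Matrix.one_apply_ne h']
  · rw [mem_standardParabolicGL_iff, hpu, coe_unitOfIsCongOne]
    exact hpl

/-- **Iwahori factorisation as a product of sets**: `K = (K ∩ U_b) · (K ∩ P_b⁻)` for the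
congruence kernel `K` of level `𝔞 ≤ Jac(O)` and any block labelling `b` (the form consumed by
`SmoothProjector.avg_eq_avg_of_coe_eq_mul`). [cite: BernsteinZelevinsky1976, §3.13] -/
theorem coe_congruenceKer_eq_mul (h𝔞 : 𝔞 ≤ Ideal.jacobson ⊥) (b : ι → α) :
    ((congruenceKer 𝔞 ι : Subgroup (GL ι O)) : Set (GL ι O)) =
      ((congruenceKer 𝔞 ι ⊓ unipotentRadicalGL O b : Subgroup (GL ι O)) : Set (GL ι O)) *
        ((congruenceKer 𝔞 ι ⊓ standardParabolicGL O (OrderDual.toDual ∘ b) : Subgroup (GL ι O)) :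
          Set (GL ι O)) := by
  ext k
  constructor
  · intro hk
    obtain ⟨u, hu, p, hp, huU, hpP, rfl⟩ := exists_unipotent_mul_lower h𝔞 b hk
    exact Set.mul_mem_mul ⟨hu, huU⟩ ⟨hp, hpP⟩
  · rintro ⟨u, ⟨hu, -⟩, p, ⟨hp, -⟩, rfl⟩
    exact Subgroup.mul_mem _ hu hp

end Iwahori

end Literature.NumberTheory.Automorphic.CongruenceKernel
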